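import Mathlib
import Summits.ValiantsHypothesis.ValiantsHypothesis.Theorems.LiouvilleSarnakAlignedTypeICharactersMod2nBilinearSieveShortCharSums
import Summits.ValiantsHypothesis.ValiantsHypothesis.Theorems.LiouvilleSarnakAlignedTypeICharactersMod2nTopLevels
import Summits.ValiantsHypothesis.ValiantsHypothesis.Theorems.LiouvilleSarnakDigitalBilinearLiouvilleRectanglesAligned
import HarnessLib

/-!
# Route LiouvilleSarnak — support `DigitalBilinearLiouville` (stmt-ValiantsHypothesis-14774):
# the aligned rung, UNCONDITIONALLY

The leaf `AlignedTypeI` (stmt-ValiantsHypothesis-21040) is now a tree theorem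
(`…BilinearSieveShortCharSums.alignedTypeI_proof`, Postnikov–Gallagher–Korobov).  This file discharges the
`AlignedTypeI` hypothesis of three conditional results already in the tree, recording the first UNCONDITIONAL rung of
the crux `DigitalBilinearLiouville` (rectangle-discrepancy form, `…DigitalBilinearLiouvilleRectangles.lean`):

* `rectangles_aligned_fullCols` — ★ on the ALIGNED cut `π₀` (low `n` bits = rows, high `n` bits = columns), EVERY set
  `A` of rows against all columns: `|Σ_{r ∈ A} Σ_c λ(N_{π₀}(r,c) + 1)| ≤ ε 4^n` eventually
  (`alignedTypeI_iff_rectangles_aligned_fullCols`; the transposed family `univ × B` was proved from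
  Matomäki–Radziwiłł in `…RectanglesAligned` / `…AlignedTypeITransposed`);
* `liouville_sqrt_level` — `λ` is `ℓ¹`-equidistributed over the odd residue classes to the modulus `2^k = √x` in
  `[1, x]`: `Σ_{u odd} |Σ_{b<2^k} λ(u + 2^k b)| ≤ ε 4^k` for large `k` (`sqrt_level_of_alignedTypeI`) — the
  `q = √x`, `2`-power-modulus case of the Klurman–Mangerel–Teräväinen-type `ℓ¹` statement, with no exceptional
  characters;
* `twistedLiouville_small` — for all large `n`, every `k ≤ n` and every Dirichlet character `χ` mod `2^k`:
  `|Σ_{m ≤ 2^{n+k}} λ(m) χ(m)| ≤ ε 2^{n+k}` (`TwistedLiouvilleSmall`, via `twistedLiouvilleSmall_of_alignedTypeI`).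

HONEST FRAMING. Unconditional corollaries of a proved LEAF; the crux `DigitalBilinearLiouville` (every balanced cut, all
test vectors) remains OPEN; nothing here bears on `VP ≠ VNP` (NOT proved).
-/

set_option linter.dupNamespace false

noncomputable section

namespace Summit.ValiantsHypothesis.ValiantsHypothesis.Theorems.LiouvilleSarnakDigitalBilinearLiouville.Rectangles

open Finset ArithmeticFunction
open Summit.ValiantsHypothesis.ValiantsHypothesis.Theorems.LiouvilleSarnak.AlignedTypeI.CharactersModTwoN

/-- ★ **Aligned rectangles `A × univ`, unconditionally**: for every `ε > 0`, eventually in `n`, for EVERY set `A` of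
row digit strings on the aligned cut, `|Σ_{r ∈ A} Σ_{c} λ(N_{π₀}(r, c) + 1)| ≤ ε 4^n`.
[cite: Ivic1985, Theorem 6.2] -/
theorem rectangles_aligned_fullCols :
    ∀ ε : ℝ, 0 < ε → ∃ n₀ : ℕ, ∀ n ≥ n₀, ∀ A : Finset (Fin n → Bool),
      |∑ r ∈ A, ∑ c : Fin n → Bool, ((liouville (Nat.ofBits (fun j : Fin (2 * n) =>
        Sum.elim r c ((finSumFinEquiv.trans (finCongr (two_mul n).symm)).symm j)) + 1) : ℤ) : ℝ)| ≤
        ε * 4 ^ n :=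
  alignedTypeI_iff_rectangles_aligned_fullCols.1 alignedTypeI_proof

/-- **`λ` is `ℓ¹`-equidistributed over the odd classes to modulus `2^k = √x`**, unconditionally: for every `ε > 0`
and all large `k`, `Σ_{u ∈ (ℤ/2^k)ˣ} |Σ_{b<2^k} λ(u + 2^k b)| ≤ ε 4^k`. [cite: Ivic1985, Theorem 6.2] -/
theorem liouville_sqrt_level :
    ∀ ε : ℝ, 0 < ε → ∃ k₀ : ℕ, ∀ k ≥ k₀,
      ∑ u : (ZMod (2 ^ k))ˣ,
        |∑ b : Fin (2 ^ k), ((liouville ((u : ZMod (2 ^ k)).val + 2 ^ k * (b : ℕ)) : ℤ) : ℝ)| ≤ ε * 4 ^ k :=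
  sqrt_level_of_alignedTypeI alignedTypeI_proof

/-- **Twisted Liouville sums to `2`-power moduli are small**, unconditionally: for every `ε > 0` and all large `n`,
every `k ≤ n` and every character `χ` mod `2^k`: `‖Σ_{m<2^{n+k}} λ(m+1) χ(m+1)‖ ≤ ε 2^{n+k}`.
[cite: Ivic1985, Theorem 6.2] -/
theorem twistedLiouville_small :
    ∀ ε : ℝ, 0 < ε → ∃ n₀ : ℕ, ∀ n ≥ n₀, ∀ k ≤ n, ∀ χ : DirichletCharacter ℂ (2 ^ k),
      ‖∑ m : Fin (2 ^ (n + k)), ((ArithmeticFunction.liouville ((m : ℕ) + 1) : ℤ) : ℂ) *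
          χ (((m : ℕ) + 1 : ℕ) : ZMod (2 ^ k))‖ ≤ ε * 2 ^ (n + k) :=
  stub_twistedLiouvilleSmall

end Summit.ValiantsHypothesis.ValiantsHypothesis.Theorems.LiouvilleSarnakDigitalBilinearLiouville.Rectangles
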